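import Literature.AlgebraicGeometry.ShimuraVarieties.UnitaryAuxiliaryTorusDatumExtPoints
import Literature.AlgebraicGeometry.ShimuraVarieties.UnitaryAuxiliaryTorusUnitLevel
import Literature.AlgebraicGeometry.ShimuraVarieties.UnitaryShimuraComplexLevelQuotient
import HarnessLib

/-!
# The Ext-tower LEVEL CHANGE `(K′, L₀′) ≤ (K, L₀)` of `Sh(G × T₀(M), X × {h_Φ})_ℂ` is a finite-group QUOTIENT
# ([Deligne1979ShimuraVarieties] 2.1.2–2.1.4, 2.7.1 (c); [Milne2005ShimuraVarieties] Rem. 5.29 (c), Lemma 5.13, (33))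

Topic `AlgebraicGeometry/ShimuraVarieties`; namespace `Literature.AlgebraicGeometry.ShimuraVarieties.UnitaryCanonicalModel.Aux`
(vocabulary of `UnitaryAuxiliaryTorusDatumExt`: `complexSystemExt M Sc L₀ = (K ↦ ∐_{p ∈ T₀(M)(ℚ)\T₀(M)(𝔸_f)/L₀} Sc.Mc_K)`,
`summandPointExt M Sc L₀ K p x a = ([x, aK], p)`, `classGroup`, `classOf`).  Cell hodgecm-mathlib (D-0151), hDel line I-1′,
receptacle v4 «Q-architecture», leaf **Q4** (B-plan2 KEY `t3-q4-ext-level-quotient`, Step D (iv): `T_K = T(N′)/G`).  ONE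
definition with body (`extLevelMap`, a morphism the receptacle's stubs NAME; D-0014 — it asserts nothing) and THEOREMS; no named
fact, no instance, no `sorry`.  HC_CM is proved only modulo the 7 printed citations until rung 0 closes; no floor binder changes.

* §3 `extLevelMap M Sc hL f : Sh_{K′×L₀′} ⟶ Sh_{K×L₀}` (`L₀′ ≤ L₀`, `f : K′ ⟶ K`): summand `p′` goes by `Sc.Mc.map f` onto summand
  `p′ mod L₀` (the transition morphism of the product datum, [Deligne1979ShimuraVarieties] 2.1.4); `ι_comp_extLevelMap`;
  `extLevelMap_summandPointExt`: on points `([x, aK′], p′) ↦ ([x, aK], p′ mod L₀)`.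
* §4 `complexSystemExt_isLevelQuotient` — **Q4**: for `L₀′ ≤ L₀` and small levels `K′ ≤ K` with `K′` normal in `K`, the compact group
  `K × L₀` acts on `Sh_{K′×L₀′}(G × T₀(M), X × {h_Φ})_ℂ` by `([x, aK′], p′) ↦ ([x, ak⁻¹K′], [l]·p′)`, the action kills `K′ × L₀′`
  (so factors through the finite `(K × L₀)/(K′ × L₀′)`), and `extLevelMap` is the quotient for separated test objects
  (`Motives.IsSepQuotient`) — ★ `ComplexRecordSystem.isLevelQuotient` on the unitary factor and ★ `Motives.isSepQuotient_sigmaDesc`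
  with `π` the class-group level change `T₀(ℚ)\T₀(𝔸_f)/L₀′ ↠ T₀(ℚ)\T₀(𝔸_f)/L₀` (★ `classGroup_map_surjective_of_le`), whose
  fibres are exactly the `L₀`-orbits (`QuotientGroup.eq`, `Subgroup.mem_sup` in the commutative `T₀(𝔸_f)`); the torus factor
  acts trivially on the summands (`X̃ = X × {h_Φ}`), so no twist appears.

* §5 `complexSystemExt_isLevelQuotient_inv` — the same with the torus index translated by `[l]⁻¹`, via the generic
  `isSepQuotient_comp_of_surjective` (precomposition of a separated-quotient action with a surjective endomorphism of the group).

Edition 2 (kernel hygiene, statements byte-identical; cell hodgecm-mathlib B-p07 g11 after A-p01's kernel-share census):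
the proofs of `extLevelMap_summandPointExt` and of §5 no longer make the kernel re-verify silent definitional junctions
across the `(complexSystemExt …).obj K = ∐ …` / `SchemeOver ℂ` instance seams (`AlgPoints.map`-rfl-simp + `congr`, and
`hq.1 _` read at the concrete carriers): the first is read on points through `AlgPoints.map_comp_apply` in the `∐`
spelling, the second through a lemma generic in the carriers; the dead 800 k budget of §5 is dropped (farm wall of the
file 110 s → 31 s, kernel share 82 s → ≈ 3 s).

## References
* [Deligne1979ShimuraVarieties] P. Deligne, *Variétés de Shimura*, PSPM XXXIII.2 (1979): 2.1.2–2.1.4 (PDF p. 24 of Milne's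
  translation), 2.7.1 (b)–(c) (PDF p. 47 L26–38).
* [Milne2005ShimuraVarieties] J. S. Milne, *Introduction to Shimura varieties* (2005): Lemma 5.13 p. 57, (33) p. 58, Rem. 5.29 (c)
  p. 65, p. 62 L34–40 (zero-dimensional Shimura varieties).
* [MumfordAV1970] D. Mumford, *Abelian Varieties* (1970), §7 Thm. p. 66 and Remark.
-/

set_option autoImplicit false

noncomputable section

open Function MulAction Topology NumberField CategoryTheory CategoryTheory.Limits Matrix AlgebraicGeometry
open scoped Matrix ComplexOrder
open Literature.AlgebraicGeometry.Motives
open Literature.NumberTheory.Automorphic Literature.NumberTheory.Automorphic.UnitaryGroup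
open Literature.NumberTheory.Automorphic.Liu2021.AppendixC (C5.OpenCompactSubgroup C5.SmallLevel)
open Literature.Geometry.ComplexHyperbolic Literature.Geometry.ComplexHyperbolic.BallModel
open Literature.NumberTheory.Automorphic.ShimuraDissection

namespace Literature.AlgebraicGeometry.ShimuraVarieties.UnitaryCanonicalModel

variable {L : Type} [Field L] [NumberField L] [IsCMField L] {H : Matrix (Fin 3) (Fin 3) L}
  {τ : L →+* ℂ} {T : GL (Fin 3) ℂ} {hT : formCongr (starRingEnd ℂ) T (H.map τ) = BallModel.J}
  {K₀ : C5.OpenCompactSubgroup ↥(finAdelic (↥(maximalRealSubfield L)) L (IsCMField.complexConj L) 3 H)}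

/-! ## §3 The level-change morphism of the Ext tower (§1–§2 = `UnitaryShimuraComplexLevelQuotient`) -/

namespace Aux

variable (M : Type) [Field M] [NumberField M] [IsCMField M]

/-- **Level change of the Ext tower along `L₀′ ≤ L₀`, `f : K′ ⟶ K`**: the summand `p′ ∈ T₀(M)(ℚ)\T₀(M)(𝔸_f)/L₀′` of
`Sh_{K′×L₀′}(G × T₀(M), X × {h_Φ})_ℂ` goes by `Sc.Mc.map f` onto the summand `p′ mod L₀` of `Sh_{K×L₀}` (the transition morphism
of the product datum, [Deligne1979ShimuraVarieties] 2.1.4, componentwise on `Sh(G,X) × Sh(T₀(M), {h_Φ})`; the index map is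
the level change of the class groups, ★ `classGroup_map_surjective_of_le`).
[cite: Deligne1979ShimuraVarieties, 2.1.4 (PDF p. 24 of Milne's translation)] [cite: Milne2005ShimuraVarieties, (33) p. 58 and p. 62 L34–40] -/
def extLevelMap (Sc : ComplexRecordSystem L H τ T hT K₀) {L₀' L₀ : C5.OpenCompactSubgroup ↥(torusFinAdelic M)} (hL : L₀' ≤ L₀)
    {K' K : C5.SmallLevel K₀} (f : K' ⟶ K) :
    (complexSystemExt M Sc L₀').obj K' ⟶ (complexSystemExt M Sc L₀).obj K :=
  Limits.Sigma.desc fun p' : classGroup M L₀' =>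
    Sc.Mc.map f ≫ Limits.Sigma.ι (fun _ : classGroup M L₀ => Sc.Mc.obj K)
      (QuotientGroup.map _ _ (MonoidHom.id ↥(torusFinAdelic M)) (sup_le_sup_left hL _) p')

/-- The `p′`-th summand inclusion followed by the level change is `Sc.Mc.map f` followed by the `(p′ mod L₀)`-th inclusion
(`Sigma.ι_desc`; definitional unfolding of `extLevelMap`). [cite: Deligne1979ShimuraVarieties, 2.1.4 (PDF p. 24 of Milne's translation)] -/
theorem ι_comp_extLevelMap (Sc : ComplexRecordSystem L H τ T hT K₀) {L₀' L₀ : C5.OpenCompactSubgroup ↥(torusFinAdelic M)}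
    (hL : L₀' ≤ L₀) {K' K : C5.SmallLevel K₀} (f : K' ⟶ K) (p' : classGroup M L₀') :
    Limits.Sigma.ι (fun _ : classGroup M L₀' => Sc.Mc.obj K') p' ≫ extLevelMap M Sc hL f =
      Sc.Mc.map f ≫ Limits.Sigma.ι (fun _ : classGroup M L₀ => Sc.Mc.obj K)
        (QuotientGroup.map _ _ (MonoidHom.id ↥(torusFinAdelic M)) (sup_le_sup_left hL _) p') :=
  Limits.Sigma.ι_desc _ _

/-- **The level change on points: `([x, aK′], p′) ↦ ([x, aK], p′ mod L₀)`.**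
[cite: Milne2005ShimuraVarieties, Lemma 5.13 p. 57 and (33) p. 58] [cite: Deligne1979ShimuraVarieties, 2.1.4 (PDF p. 24 of Milne's translation)] -/
theorem extLevelMap_summandPointExt (Sc : ComplexRecordSystem L H τ T hT K₀) {L₀' L₀ : C5.OpenCompactSubgroup ↥(torusFinAdelic M)}
    (hL : L₀' ≤ L₀) {K' K : C5.SmallLevel K₀} (f : K' ⟶ K) (p' : classGroup M L₀') (x : Ball)
    (a : finAdelic (↥(maximalRealSubfield L)) L (IsCMField.complexConj L) 3 H) :
    AlgPoints.map (extLevelMap M Sc hL f) (summandPointExt M Sc L₀' K' p' x a) =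
      summandPointExt M Sc L₀ K (QuotientGroup.map _ _ (MonoidHom.id ↥(torusFinAdelic M)) (sup_le_sup_left hL _) p') x a := by
  rw [summandPointExt, summandPointExt, ← Sc.map_pts_symm K' K f x a]
  -- restate in the `∐` spelling (the `(complexSystemExt …).obj` seam), then read `ι_comp_extLevelMap` on the point
  change AlgPoints.map (extLevelMap M Sc hL f)
      (AlgPoints.map (Limits.Sigma.ι (fun _ : classGroup M L₀' => Sc.Mc.obj K') p')
        ((Sc.pts K').symm (ShimuraSet.mk L H τ T hT K'.1.1 x a))) =
    AlgPoints.map (Limits.Sigma.ι (fun _ : classGroup M L₀ => Sc.Mc.obj K)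
        (QuotientGroup.map _ _ (MonoidHom.id ↥(torusFinAdelic M)) (sup_le_sup_left hL _) p'))
      (AlgPoints.map (Sc.Mc.map f) ((Sc.pts K').symm (ShimuraSet.mk L H τ T hT K'.1.1 x a)))
  rw [← AlgPoints.map_comp_apply, ← AlgPoints.map_comp_apply]
  exact congrArg (fun φ => AlgPoints.map φ ((Sc.pts K').symm (ShimuraSet.mk L H τ T hT K'.1.1 x a)))
    (ι_comp_extLevelMap M Sc hL f p')

/-! ## §4 Q4: the Ext-tower level change is a finite-group quotient -/

set_option maxHeartbeats 1600000 in -- large adelic / Shimura-set terms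
/-- **Q4. The Ext-tower level change `(K′, L₀′) ≤ (K, L₀)` is a finite-group quotient** (over `ℂ`, for ANY complex record system
`Sc`; no rational model used): for `L₀′ ≤ L₀ ≤ T₀(M)(𝔸_f)` and small levels `K′ ≤ K` with `k⁻¹K′k ⊆ K′` for `k ∈ K`, the compact
group `K × L₀` acts on `Sh_{K′×L₀′}(G × T₀(M), X × {h_Φ})_ℂ = ∐_{p′} Sc.Mc_{K′}` by `ℂ`-automorphisms, `(k, l)` sending the point
`([x, aK′], p′)` to `([x, ak⁻¹K′], [l]·p′)` (Hecke translate on the unitary factor, §2; re-indexing of the summands by the torus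
factor, which acts trivially on `X̃ = X × {h_Φ}`); the action kills `K′ × L₀′` (so factors through the finite
`(K × L₀)/(K′ × L₀′)`); and the level change `extLevelMap` is the quotient by this action for separated test objects
(`Motives.IsSepQuotient`) — §2 for the unitary factor and the categorical lemma §1 with `π` the class-group level change
`T₀(ℚ)\T₀(𝔸_f)/L₀′ ↠ T₀(ℚ)\T₀(𝔸_f)/L₀` (★ `classGroup_map_surjective_of_le`), whose fibres are exactly the `L₀`-orbits
(`QuotientGroup.eq`, `Subgroup.mem_sup` in the commutative `T₀(𝔸_f)`).  [Deligne1979ShimuraVarieties] 2.7.1 (c) / 2.1.2–2.1.4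
for the product datum `(G × T₀(M), X × {h_Φ})`; [Milne2005ShimuraVarieties] Rem. 5.29 (c) «`S_K` is the quotient of `S_{K′}` by
the action of `K/K′`».
[cite: Deligne1979ShimuraVarieties, 2.7.1 (c) (PDF p. 47 L34–38) and 2.1.2–2.1.4 (PDF p. 24 of Milne's translation)]
[cite: Milne2005ShimuraVarieties, Rem. 5.29 (c) p. 65; Lemma 5.13 p. 57; (33) p. 58; p. 62 L34–40] [cite: MumfordAV1970, §7 Thm. p. 66 (Remark)] -/
theorem complexSystemExt_isLevelQuotient (Sc : ComplexRecordSystem L H τ T hT K₀)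
    {L₀' L₀ : C5.OpenCompactSubgroup ↥(torusFinAdelic M)} (hL : L₀' ≤ L₀) {K' K : C5.SmallLevel K₀} (h : K' ≤ K)
    (hn : ∀ k ∈ K.1.1, ∀ n ∈ K'.1.1, k⁻¹ * n * k ∈ K'.1.1) :
    ∃ act : (↥K.1.1 × ↥L₀.1) →* Aut ((complexSystemExt M Sc L₀').obj K'),
      (∀ (k : ↥K.1.1) (l : ↥L₀.1) (p' : classGroup M L₀') (x : Ball)
          (a : finAdelic (↥(maximalRealSubfield L)) L (IsCMField.complexConj L) 3 H),
          AlgPoints.map (act (k, l)).hom (summandPointExt M Sc L₀' K' p' x a) =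
            summandPointExt M Sc L₀' K' (classOf M L₀' (l : ↥(torusFinAdelic M)) * p') x
              (a * ((k : finAdelic (↥(maximalRealSubfield L)) L (IsCMField.complexConj L) 3 H))⁻¹)) ∧
      (∀ g : ↥K.1.1 × ↥L₀.1, (g.1 : finAdelic (↥(maximalRealSubfield L)) L (IsCMField.complexConj L) 3 H) ∈ K'.1.1 →
          (g.2 : ↥(torusFinAdelic M)) ∈ L₀'.1 → act g = 1) ∧
      Motives.IsSepQuotient (fun g => act g) (extLevelMap M Sc hL (homOfLE h)) := by
  classical
  -- the class-group level change `π : T₀(ℚ)\T₀(𝔸_f)/L₀′ ↠ T₀(ℚ)\T₀(𝔸_f)/L₀`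
  let πh : classGroup M L₀' →* classGroup M L₀ :=
    QuotientGroup.map _ _ (MonoidHom.id ↥(torusFinAdelic M)) (sup_le_sup_left hL _)
  have hπ : Function.Surjective πh := classGroup_map_surjective_of_le M hL
  have hπmk : ∀ t : ↥(torusFinAdelic M), πh (classOf M L₀' t) = classOf M L₀ t := fun _ => rfl
  have hmemL : ∀ {L₁ : C5.OpenCompactSubgroup ↥(torusFinAdelic M)} (t : ↥(torusFinAdelic M)), t ∈ L₁.1 →
      classOf M L₁ t = 1 := fun t ht => (QuotientGroup.eq_one_iff t).2 (Subgroup.mem_sup_right ht)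
  have hmemX : ∀ {L₁ : C5.OpenCompactSubgroup ↥(torusFinAdelic M)} (t : ↥(torusFinAdelic M)),
      t ∈ (toTorusFinAdelic M).range → classOf M L₁ t = 1 := fun t ht =>
    (QuotientGroup.eq_one_iff t).2 (Subgroup.mem_sup_left ht)
  -- §2 on the unitary factor
  obtain ⟨actU, hactU, hkerU, hqU⟩ := Sc.isLevelQuotient h hn
  -- the summand action `ρ` and the index permutation `σ` of `γ = (k, l)`
  let ρ : ↥K.1.1 × ↥L₀.1 → (Sc.Mc.obj K' ≅ Sc.Mc.obj K') := fun γ => actU γ.1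
  let c : ↥K.1.1 × ↥L₀.1 → classGroup M L₀' := fun γ => classOf M L₀' (γ.2 : ↥(torusFinAdelic M))
  let σ : ↥K.1.1 × ↥L₀.1 → classGroup M L₀' → classGroup M L₀' := fun γ i => c γ * i
  have hc_one : c 1 = 1 := by
    change classOf M L₀' ((1 : ↥L₀.1) : ↥(torusFinAdelic M)) = 1
    rw [OneMemClass.coe_one, map_one]
  have hc_mul : ∀ γ γ' : ↥K.1.1 × ↥L₀.1, c (γ * γ') = c γ * c γ' := fun γ γ' => by
    change classOf M L₀' ((γ.2 * γ'.2 : ↥L₀.1) : ↥(torusFinAdelic M)) =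
      classOf M L₀' (γ.2 : ↥(torusFinAdelic M)) * classOf M L₀' (γ'.2 : ↥(torusFinAdelic M))
    rw [Subgroup.coe_mul, map_mul]
  have hρ_one : (ρ 1).hom = 𝟙 (Sc.Mc.obj K') := by
    change (actU 1).hom = 𝟙 (Sc.Mc.obj K')
    rw [map_one]; rfl
  have hρ_mul : ∀ γ γ' : ↥K.1.1 × ↥L₀.1, (ρ (γ * γ')).hom = (ρ γ').hom ≫ (ρ γ).hom := fun γ γ' => by
    change (actU (γ.1 * γ'.1)).hom = (actU γ'.1).hom ≫ (actU γ.1).hom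
    rw [map_mul, Aut.Aut_mul_def]; rfl
  -- the automorphisms `A γ` of the coproduct `∐_{p′} Sc.Mc_{K′}` (= `(complexSystemExt M Sc L₀′).obj K′` definitionally)
  let Ahom : ↥K.1.1 × ↥L₀.1 →
      ((∐ fun _ : classGroup M L₀' => Sc.Mc.obj K') ⟶ (∐ fun _ : classGroup M L₀' => Sc.Mc.obj K')) := fun γ =>
    Limits.Sigma.desc fun i : classGroup M L₀' =>
      (ρ γ).hom ≫ Limits.Sigma.ι (fun _ : classGroup M L₀' => Sc.Mc.obj K') (σ γ i)
  have hAι : ∀ (γ : ↥K.1.1 × ↥L₀.1) (i : classGroup M L₀'),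
      Limits.Sigma.ι (fun _ : classGroup M L₀' => Sc.Mc.obj K') i ≫ Ahom γ =
        (ρ γ).hom ≫ Limits.Sigma.ι (fun _ : classGroup M L₀' => Sc.Mc.obj K') (σ γ i) :=
    fun γ i => Limits.Sigma.ι_desc _ _
  have hσ_one : ∀ i : classGroup M L₀', σ 1 i = i := fun i => by
    change c 1 * i = i
    rw [hc_one]
    exact one_mul i
  have hA_one : Ahom 1 = 𝟙 _ := Limits.Sigma.hom_ext _ _ fun i => by
    rw [hAι, hρ_one, Category.id_comp, Category.comp_id, hσ_one]
  have hA_mul : ∀ γ γ' : ↥K.1.1 × ↥L₀.1, Ahom (γ * γ') = Ahom γ' ≫ Ahom γ := fun γ γ' =>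
    Limits.Sigma.hom_ext _ _ fun i => by
      rw [hAι, ← Category.assoc, hAι, Category.assoc, hAι, ← Category.assoc, ← hρ_mul]
      change (ρ (γ * γ')).hom ≫ Limits.Sigma.ι (fun _ : classGroup M L₀' => Sc.Mc.obj K') (c (γ * γ') * i) =
        (ρ (γ * γ')).hom ≫ Limits.Sigma.ι (fun _ : classGroup M L₀' => Sc.Mc.obj K') (c γ * (c γ' * i))
      rw [hc_mul, mul_assoc]
  have hAA : ∀ γ : ↥K.1.1 × ↥L₀.1, Ahom γ ≫ Ahom γ⁻¹ = 𝟙 _ := fun γ => by rw [← hA_mul, inv_mul_cancel, hA_one]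
  have hAA' : ∀ γ : ↥K.1.1 × ↥L₀.1, Ahom γ⁻¹ ≫ Ahom γ = 𝟙 _ := fun γ => by rw [← hA_mul, mul_inv_cancel, hA_one]
  let act : (↥K.1.1 × ↥L₀.1) →* Aut (∐ fun _ : classGroup M L₀' => Sc.Mc.obj K') :=
    { toFun := fun γ => ⟨Ahom γ, Ahom γ⁻¹, hAA γ, hAA' γ⟩
      map_one' := Iso.ext hA_one
      map_mul' := fun γ γ' => Iso.ext (by rw [Aut.Aut_mul_def]; exact hA_mul γ γ') }
  have act_hom : ∀ γ : ↥K.1.1 × ↥L₀.1, (act γ).hom = Ahom γ := fun _ => rfl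
  -- hypotheses of the categorical lemma §1
  have horb : ∀ i i' : classGroup M L₀', πh i = πh i' ↔ ∃ γ : ↥K.1.1 × ↥L₀.1, σ γ i = i' := by
    intro i i'
    constructor
    · intro hii'
      induction i using QuotientGroup.induction_on with
      | H t =>
        induction i' using QuotientGroup.induction_on with
        | H t' =>
          have he : classOf M L₀ t = classOf M L₀ t' := hii'
          obtain ⟨y, hy, l, hl, hyl⟩ := Subgroup.mem_sup.1 ((QuotientGroup.eq (s := _)).1 he)
          refine ⟨(1, ⟨l, hl⟩), ?_⟩
          change classOf M L₀' l * classOf M L₀' t = classOf M L₀' t'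
          have ht' : t' = t * (y * l) := by rw [hyl, mul_inv_cancel_left]
          rw [ht', map_mul, map_mul, hmemX y hy]
          exact (mul_comm (classOf M L₀' l) (classOf M L₀' t)).trans
            (congrArg (fun u => classOf M L₀' t * u) (one_mul (classOf M L₀' l)).symm)
    · rintro ⟨γ, rfl⟩
      change πh i = πh (c γ * i)
      rw [map_mul]
      change πh i = classOf M L₀ (γ.2 : ↥(torusFinAdelic M)) * πh i
      rw [hmemL _ γ.2.2]
      exact (one_mul (πh i)).symm
  have hstab : ∀ (γ : ↥K.1.1 × ↥L₀.1) (i : classGroup M L₀'), ∃ γ' : ↥K.1.1 × ↥L₀.1, σ γ' i = i ∧ ρ γ' = ρ γ :=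
    fun γ i => ⟨(γ.1, 1), hσ_one i, rfl⟩
  have hq : IsSepQuotient ρ (Sc.Mc.map (homOfLE h)) :=
    ⟨fun γ => hqU.1 γ.1, fun W f hW hf => hqU.2 W f hW fun k => hf (k, 1)⟩
  have hquot := Motives.isSepQuotient_sigmaDesc ρ σ (fun γ => act γ) (fun γ i => hAι γ i) πh hπ horb hstab hq
  -- the action on summand points
  have hpts : ∀ (k : ↥K.1.1) (l : ↥L₀.1) (p' : classGroup M L₀') (x : Ball)
      (a : finAdelic (↥(maximalRealSubfield L)) L (IsCMField.complexConj L) 3 H),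
      AlgPoints.map (act (k, l)).hom (summandPointExt M Sc L₀' K' p' x a) =
        summandPointExt M Sc L₀' K' (classOf M L₀' (l : ↥(torusFinAdelic M)) * p') x
          (a * ((k : finAdelic (↥(maximalRealSubfield L)) L (IsCMField.complexConj L) 3 H))⁻¹) := by
    intro k l p' x a
    rw [summandPointExt, summandPointExt, ← hactU k x a, act_hom]
    -- restate in the `∐` spelling (the `(complexSystemExt …).obj K′` seam), then read `hAι` on the point
    change AlgPoints.map (Ahom (k, l))
        (AlgPoints.map (Limits.Sigma.ι (fun _ : classGroup M L₀' => Sc.Mc.obj K') p')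
          ((Sc.pts K').symm (ShimuraSet.mk L H τ T hT K'.1.1 x a))) =
      AlgPoints.map (Limits.Sigma.ι (fun _ : classGroup M L₀' => Sc.Mc.obj K')
          (classOf M L₀' (l : ↥(torusFinAdelic M)) * p'))
        (AlgPoints.map (actU k).hom ((Sc.pts K').symm (ShimuraSet.mk L H τ T hT K'.1.1 x a)))
    rw [← AlgPoints.map_comp_apply, ← AlgPoints.map_comp_apply]
    exact congrArg (fun φ => AlgPoints.map φ ((Sc.pts K').symm (ShimuraSet.mk L H τ T hT K'.1.1 x a))) (hAι (k, l) p')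
  -- it kills `K′ × L₀′`
  have hkill : ∀ γ : ↥K.1.1 × ↥L₀.1,
      (γ.1 : finAdelic (↥(maximalRealSubfield L)) L (IsCMField.complexConj L) 3 H) ∈ K'.1.1 →
        (γ.2 : ↥(torusFinAdelic M)) ∈ L₀'.1 → act γ = 1 := by
    intro γ hk hl
    refine Iso.ext (Limits.Sigma.hom_ext _ _ fun i => ?_)
    rw [act_hom, hAι]
    change (actU γ.1).hom ≫ Limits.Sigma.ι (fun _ : classGroup M L₀' => Sc.Mc.obj K') (c γ * i) =
      Limits.Sigma.ι (fun _ : classGroup M L₀' => Sc.Mc.obj K') i ≫ 𝟙 _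
    rw [hkerU γ.1 hk, Category.comp_id]
    change 𝟙 (Sc.Mc.obj K') ≫ Limits.Sigma.ι (fun _ : classGroup M L₀' => Sc.Mc.obj K')
        (classOf M L₀' (γ.2 : ↥(torusFinAdelic M)) * i) = _
    rw [hmemL _ hl, Category.id_comp]
    exact congrArg _ (one_mul i)
  exact ⟨act, hpts, hkill, hquot⟩


/-! ## §5 The same quotient with the torus index translated by `[l]⁻¹` (the KEY's reading; bridge for `stub_Squot` D2) -/

/-- Precomposing a separated-quotient action `act : Γ →* Aut Y` with a SURJECTIVE endomorphism `θ` of `Γ` (same set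
of acting automorphisms) keeps the quotient property ([MumfordAV1970] §7 Remark: the categorical quotient depends only on
the acting automorphisms).  Generic in the carriers `Y`, `Z` and in `Γ` — stated over variables so that the kernel decides
the `(act.comp θ) g = act (θ g)` bookkeeping outside any concrete `SchemeOver ℂ` composite (kernel-hygiene edition;
the variable-level transport is A-p01's `isSepQuotient_precomp` cut). [cite: MumfordAV1970, §7 Thm. p. 66 (Remark)] -/
theorem isSepQuotient_comp_of_surjective {Y Z : SchemeOver ℂ} {Γ : Type} [Group Γ]
    (act : Γ →* Aut Y) (θ : Γ →* Γ) (hθ : Function.Surjective θ) {p : Y ⟶ Z}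
    (hq : Motives.IsSepQuotient (fun g => act g) p) :
    Motives.IsSepQuotient (fun g => (act.comp θ) g) p := by
  refine ⟨fun g => hq.1 (θ g), fun W f hW hf => hq.2 W f hW fun g => ?_⟩
  obtain ⟨g', rfl⟩ := hθ g
  exact hf g'

/-- **Q4 with the inverse torus convention**: the action of `K × L₀` on `Sh_{K′×L₀′}(G × T₀(M), X × {h_Φ})_ℂ` may equally be taken
as `([x, aK′], p′) ↦ ([x, ak⁻¹K′], [l]⁻¹·p′)` — precompose the action of `complexSystemExt_isLevelQuotient` with the automorphism
`(k, l) ↦ (k, l⁻¹)` of `K × L₀` (a homomorphism because the torus factor is commutative); the kernel clause and the quotient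
property are unchanged (same set of automorphisms).  With this convention the matching Siegel-side translate under the symplectic
embedding `ũ` is `ũ((k,l)⁻¹)` on the nose ([Deligne1979ShimuraVarieties] 2.1.2–2.1.4, 2.7.1 (c) for the product datum).
[cite: Deligne1979ShimuraVarieties, 2.7.1 (c) (PDF p. 47 L34–38) and 2.1.2–2.1.4 (PDF p. 24 of Milne's translation)]
[cite: Milne2005ShimuraVarieties, Rem. 5.29 (c) p. 65; (33) p. 58] -/
theorem complexSystemExt_isLevelQuotient_inv (Sc : ComplexRecordSystem L H τ T hT K₀)
    {L₀' L₀ : C5.OpenCompactSubgroup ↥(torusFinAdelic M)} (hL : L₀' ≤ L₀) {K' K : C5.SmallLevel K₀} (h : K' ≤ K)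
    (hn : ∀ k ∈ K.1.1, ∀ n ∈ K'.1.1, k⁻¹ * n * k ∈ K'.1.1) :
    ∃ act : (↥K.1.1 × ↥L₀.1) →* Aut ((complexSystemExt M Sc L₀').obj K'),
      (∀ (k : ↥K.1.1) (l : ↥L₀.1) (p' : classGroup M L₀') (x : Ball)
          (a : finAdelic (↥(maximalRealSubfield L)) L (IsCMField.complexConj L) 3 H),
          AlgPoints.map (act (k, l)).hom (summandPointExt M Sc L₀' K' p' x a) =
            summandPointExt M Sc L₀' K' (classOf M L₀' ((l : ↥(torusFinAdelic M)))⁻¹ * p') x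
              (a * ((k : finAdelic (↥(maximalRealSubfield L)) L (IsCMField.complexConj L) 3 H))⁻¹)) ∧
      (∀ g : ↥K.1.1 × ↥L₀.1, (g.1 : finAdelic (↥(maximalRealSubfield L)) L (IsCMField.complexConj L) 3 H) ∈ K'.1.1 →
          (g.2 : ↥(torusFinAdelic M)) ∈ L₀'.1 → act g = 1) ∧
      Motives.IsSepQuotient (fun g => act g) (extLevelMap M Sc hL (homOfLE h)) := by
  obtain ⟨act, hpts, hker, hq⟩ := complexSystemExt_isLevelQuotient M Sc hL h hn
  let θ : (↥K.1.1 × ↥L₀.1) →* (↥K.1.1 × ↥L₀.1) := MonoidHom.prodMap (MonoidHom.id _) invMonoidHom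
  have hθ : ∀ g : ↥K.1.1 × ↥L₀.1, θ g = (g.1, g.2⁻¹) := fun _ => rfl
  have hθθ : ∀ g : ↥K.1.1 × ↥L₀.1, θ (θ g) = g := fun g => by rw [hθ, hθ, inv_inv]
  refine ⟨act.comp θ, fun k l p' x a => ?_, fun g hk hl => ?_,
    isSepQuotient_comp_of_surjective act θ (fun g => ⟨θ g, hθθ g⟩) hq⟩
  · rw [MonoidHom.comp_apply, hθ, hpts]
    rfl
  · rw [MonoidHom.comp_apply, hθ]
    exact hker _ hk (L₀'.1.inv_mem hl)

end Aux

end Literature.AlgebraicGeometry.ShimuraVarieties.UnitaryCanonicalModel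

end
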